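import Summits.QuantumFields.YangMills.Theorems.FlatTubeReductionDecimationSelection
import HarnessLib

/-!
# Route `FlatTubeReduction`, crux `PinnedUnitStepEx` (stmt-QuantumFields-27561), stub `stub_smearVarPosGS1` — E1b: classification of decoders

Seat ym-line-fcl-p3 g9 (2026-08-28).  Blueprint v2 file E1 (second part).  For a coarse link set `R` in NORMAL FORM in direction `j` (slices `1..ℓ`
contractible, `0 < ℓ < L'`) and any DECODER `(v', R')` of its fine support (`fineSupp (L'+1) v' R' = fineSupp (L'+1) 0 R`):
* `isContr_fineSupp_zero_iff` — the contractible fine slices are `1` and the `ι a` with `a` contractible; `fine_run_of_normalForm` — so `1, …, ℓ+1` is a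
  fine run;
* `hasWin_decoded_of_normalForm` (γ, ≥): `R'` has a window of length `ℓ` — the potential never drops; `hasWin_succ_decoded_of_not_mem_run` /
  ★ `decoder_mem_run`: unless `v'_j = −m` with `m ≤ ℓ` (deleted slice inside the fine run), `R'` has a window of length `ℓ+1` — a non-trivial
  decoder RAISES the potential;
* `isContr_decoded_of_all` (β: Polyakov directions persist), `decoder_eq_zero_of_none` (α: no contractible slice forces `v'_j = 0`).
R2b1 RECORD rung; no summit/crux/stub here.
-/

set_option autoImplicit false

noncomputable section

namespace Summit.QuantumFields.YangMills.Theorems.FlatTubeReduction.Decimation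

open Finset Function
open Literature.MathematicalPhysics.QuantumFieldTheory (Site Edge)
open Summit.QuantumFields.YangMills.Theorems.FemtoCutoffLadder.Thinning

variable {L' : ℕ} [NeZero L']

/-! ## The fine support of a link set in normal form -/

/-- Every fine coordinate is the deleted one (`1`, decoder `0`) or the image `ι a` of a coarse one. [folklore] -/
theorem fine_coord_cases (c : ZMod (L' + 1)) : c = 1 ∨ ∃ a : ZMod L', thinCoord (L' + 1) L' a = c := by
  by_cases hc : c = 1
  · exact Or.inl hc
  · exact Or.inr (exists_thinCoord_eq hc)

/-- **Contractible fine slices of `fineSupp 0 R`**: exactly the deleted slice `1` and the images of the contractible coarse slices. [folklore] -/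
theorem isContr_fineSupp_zero_iff (R : Finset (Edge 3 L')) (j : Fin 3) (c : ZMod (L' + 1)) :
    IsContr j c (fineSupp (L' + 1) 0 R) ↔ c = 1 ∨ ∃ a : ZMod L', thinCoord (L' + 1) L' a = c ∧ IsContr j a R := by
  constructor
  · intro h
    rcases fine_coord_cases c with hc | ⟨a, rfl⟩
    · exact Or.inl hc
    · refine Or.inr ⟨a, rfl, ?_⟩
      have := (isContr_fineSupp_iff (0 : Site 3 (L' + 1)) R j a)
      rw [Pi.zero_apply, sub_zero] at this
      exact this.1 h
  · rintro (rfl | ⟨a, rfl, ha⟩)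
    · have := isContr_fineSupp_deleted (0 : Site 3 (L' + 1)) R j
      rwa [Pi.zero_apply, sub_zero] at this
    · have := (isContr_fineSupp_iff (0 : Site 3 (L' + 1)) R j a).2 ha
      rwa [Pi.zero_apply, sub_zero] at this

/-- In the frame at `L = L'+1`: `ι(1 + i) = 2 + i` for `1 + i < L'` (no doubled step after coordinate `0`). [folklore] -/
theorem thinCoord_one_add {i : ℕ} (hi : 1 + i < L') :
    thinCoord (L' + 1) L' (1 + (i : ZMod L')) = 2 + (i : ZMod (L' + 1)) := by
  have h := thinCoord_add_nat_of_ne_zero (L' := L') 1 i (fun i' hi' h0 => by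
    have : ((1 + i' : ℕ) : ZMod L') = 0 := by push_cast; exact h0
    rw [ZMod.natCast_eq_zero_iff] at this
    exact absurd (Nat.le_of_dvd (by omega) this) (by omega))
  rw [h]
  have h1 : thinCoord (L' + 1) L' (1 : ZMod L') = 2 := by
    haveI : Fact (1 < L') := ⟨by omega⟩
    apply ZMod.val_injective
    rw [thinCoord_val (Nat.le_succ L'), ZMod.val_one]
    have : ((2 : ZMod (L' + 1))).val = 2 := by
      rw [show (2 : ZMod (L' + 1)) = ((2 : ℕ) : ZMod (L' + 1)) by norm_cast, ZMod.val_natCast]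
      exact Nat.mod_eq_of_lt (by omega)
    rw [this]; omega
  rw [h1]

/-- **The fine run of a normal-form link set**: if the coarse slices `1, …, ℓ` (`ℓ < L'`) are contractible then the fine slices `1, 2, …, ℓ+1` of
`fineSupp 0 R` are contractible (the deleted slice `1` followed by the images `ι(1+i) = 2+i`). [folklore] -/
theorem fine_run_of_normalForm {R : Finset (Edge 3 L')} {j : Fin 3} {ℓ : ℕ} (hℓ : ℓ < L')
    (hrun : ∀ i : ℕ, i < ℓ → IsContr j (1 + (i : ZMod L')) R) :
    ∀ i : ℕ, i ≤ ℓ → IsContr j ((1 : ZMod (L' + 1)) + (i : ZMod (L' + 1))) (fineSupp (L' + 1) 0 R) := by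
  intro i hi
  rcases i with _ | i
  · rw [Nat.cast_zero, add_zero]
    exact (isContr_fineSupp_zero_iff R j 1).2 (Or.inl rfl)
  · refine (isContr_fineSupp_zero_iff R j _).2 (Or.inr ⟨1 + (i : ZMod L'), ?_, hrun i (by omega)⟩)
    rw [thinCoord_one_add (by omega)]
    push_cast; ring

/-! ## Classification of decoders of the fine support of a normal-form link set -/

/-- **(β) Polyakov directions persist**: if every coarse `j`-slice of `R` is contractible, then so is every `j`-slice of any decoded `R'`. [folklore] -/
theorem isContr_decoded_of_all {R R' : Finset (Edge 3 L')} {v' : Site 3 (L' + 1)} (hF : fineSupp (L' + 1) v' R' = fineSupp (L' + 1) 0 R)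
    {j : Fin 3} (hall : ∀ a : ZMod L', IsContr j a R) (a : ZMod L') : IsContr j a R' := by
  rw [isContr_decoded_iff hF]
  rcases fine_coord_cases (thinCoord (L' + 1) L' a - v' j) with hc | ⟨b, hb⟩
  · rw [hc]; exact (isContr_fineSupp_zero_iff R j 1).2 (Or.inl rfl)
  · rw [← hb]; exact (isContr_fineSupp_zero_iff R j _).2 (Or.inr ⟨b, rfl, hall b⟩)

/-- **(α) No contractible slice ⇒ trivial decoder component**: if `R` has no contractible coarse `j`-slice then any decoder `v'` of `fineSupp 0 R`
has `v'_j = 0` (its deleted slice must be contractible, and only the slice `1` is). [folklore] -/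
theorem decoder_eq_zero_of_none {R R' : Finset (Edge 3 L')} {v' : Site 3 (L' + 1)} (hF : fineSupp (L' + 1) v' R' = fineSupp (L' + 1) 0 R)
    {j : Fin 3} (hnone : ∀ a : ZMod L', ¬ IsContr j a R) : v' j = 0 := by
  have h := isContr_fineSupp_deleted v' R' j
  rw [hF, isContr_fineSupp_zero_iff] at h
  rcases h with h | ⟨a, -, ha⟩
  · have := congrArg (fun x => 1 - x) h
    simpa using this
  · exact absurd ha (hnone a)

/-- **(γ) Decoded link sets keep a window of length `ℓ`**: in normal form (coarse slices `1..ℓ` contractible, `0 < ℓ < L'`) every decoder `R'` has a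
window of `ℓ` consecutive contractible `j`-slices. [folklore] -/
theorem hasWin_decoded_of_normalForm {R R' : Finset (Edge 3 L')} {v' : Site 3 (L' + 1)} (hF : fineSupp (L' + 1) v' R' = fineSupp (L' + 1) 0 R)
    {j : Fin 3} {ℓ : ℕ} (hℓ0 : 0 < ℓ) (hℓ : ℓ < L') (hrun : ∀ i : ℕ, i < ℓ → IsContr j (1 + (i : ZMod L')) R) : HasWin j R' ℓ := by
  have hfine := fine_run_of_normalForm hℓ hrun
  obtain ⟨a, ha⟩ := hasWindow_decoded_of_fine_window hF j (c := 1) (t := ℓ - 1) (by omega)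
    (fun i hi => hfine i (by omega))
  exact ⟨a, fun i hi => ha i (by omega)⟩

/-- **(γ) … and a longer one unless the deleted slice lies in the fine run**: if moreover `1 − v'_j ∉ {1, …, ℓ+1}` then `R'` has a window of
length `ℓ+1`. [folklore] -/
theorem hasWin_succ_decoded_of_not_mem_run {R R' : Finset (Edge 3 L')} {v' : Site 3 (L' + 1)}
    (hF : fineSupp (L' + 1) v' R' = fineSupp (L' + 1) 0 R) {j : Fin 3} {ℓ : ℕ} (hℓ : ℓ < L')
    (hrun : ∀ i : ℕ, i < ℓ → IsContr j (1 + (i : ZMod L')) R)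
    (hout : ∀ m : ℕ, m ≤ ℓ → (1 : ZMod (L' + 1)) + (m : ZMod (L' + 1)) ≠ 1 - v' j) : HasWin j R' (ℓ + 1) := by
  have hfine := fine_run_of_normalForm hℓ hrun
  obtain ⟨a, ha⟩ := hasWindow_decoded_of_fine_window_avoiding hF j (c := 1) (t := ℓ) hfine hout
  exact ⟨a, fun i hi => ha i (by omega)⟩

/-- **Trivial decoder components**: in normal form, a decoder whose decoded set has NO window of length `ℓ+1` deletes a slice of the fine run:
`v'_j = −m` for some `m ≤ ℓ`. [folklore] -/
theorem decoder_mem_run {R R' : Finset (Edge 3 L')} {v' : Site 3 (L' + 1)} (hF : fineSupp (L' + 1) v' R' = fineSupp (L' + 1) 0 R)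
    {j : Fin 3} {ℓ : ℕ} (hℓ : ℓ < L') (hrun : ∀ i : ℕ, i < ℓ → IsContr j (1 + (i : ZMod L')) R) (hno : ¬ HasWin j R' (ℓ + 1)) :
    ∃ m : ℕ, m ≤ ℓ ∧ v' j = -(m : ZMod (L' + 1)) := by
  by_contra hcon
  push Not at hcon
  refine hno (hasWin_succ_decoded_of_not_mem_run hF hℓ hrun fun m hm h => hcon m hm ?_)
  linear_combination h

end Summit.QuantumFields.YangMills.Theorems.FlatTubeReduction.Decimation
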